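import Summits.HodgeConjecture.CorCM.Model.FourierSum
import Summits.HodgeConjecture.CorCM.Model.FourierOpInjective
import Summits.HodgeConjecture.CorCM.Model.DiagonalDegree
import Mathlib.LinearAlgebra.FiniteDimensional.Lemmas
import HarnessLib

/-!
# COR-CM model layer, row M22 `Fact_algDuality`, clause (o): the Fourier word sum is bijective

Cell `pub-hodgecm2` (COR-CM), binder seat b23 (author of record for clause (o) per the lead's ROSTER v3.3 and
model-1's M22 INTERFACE v1, 2026-08-20).  The shared SOCKET of row M22 is model-1's
`Model.fourierSum hX x y i h : Hʲ(X(ℂ); ℚ) →ₗ[ℚ] Hⁱ(X(ℂ); ℚ)`, `z ↦ Σ_{c : Fin i → Fin N} tr_X(z ∪ m_i(x ∘ c)) • m_i(y ∘ c)`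
(`CorCM/Model/FourierSum.lean`; `m_i = cupPowOne ℚ`, `tr_X = BettiUniverse.tr hX (2n)` the light trace).  THIS FILE
states clause (o) of `Fact_algDuality` AGAINST THE SOCKET, for the variety `X = A.X` underlying a complex abelian
variety and a general smooth-projective witness `hX : IsSmoothProjective n A.X` (interface convention (c)):

* `fourierSum_bijective` — for bases `b y` of `H¹(A(ℂ); ℚ)` indexed by `Fin N` and `j + i = 2n`,
  `fourierSum hX b y i h` is a linear bijection `Hʲ(A(ℂ); ℚ) → Hⁱ(A(ℂ); ℚ)`;
* `fourierSum_bijective_of_linearIndependent` — the same with the partner family `y : Fin N → H¹(A(ℂ); ℚ)` only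
  assumed linearly independent (it is then a basis, `N = dim H¹`), the form in which K-a feeds the `θ`-polar family.

The mathematics (regrouping of the word sum over `i`-subsets, independence of the cup monomials of a basis through
`H• = ⋀• H¹`, Poincaré duality for the light trace) is b29's `bijective_of_eq_fourierSum`
(`CorCM/Model/FourierOpInjective.lean`, the Betti transcription of the tree's `WeilCohomology.fourierOp_injective`);
here it is instantiated at `τ = BettiUniverse.tr hX (2n)` (injective on the top line: model-2's `tr_top_injective`)
with `2n = 2 dim A` from model-1's `dim_unique`.  No definitions, no named facts.

References: Kleiman, *Algebraic cycles and the Weil conjectures* (1968) App. 2A; Beauville, LNM 1016 (1983) Prop. 1.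
-/

noncomputable section

open CategoryTheory
open Literature.AlgebraicTopology.SingularHomology
open Literature.AlgebraicGeometry.Motives (SchemeOver ComplexPoints IsSmoothProjective bettiCohomology AbelianVariety)
open Literature.AlgebraicGeometry.HodgeTheory

namespace Summit.HodgeConjecture.CorCM.Model

variable (A : AbelianVariety ℂ) {n : ℕ}

/-- **Row M22, clause (o): the Fourier word sum of a complex abelian variety is bijective.**  For bases `b`, `y`
of `H¹(A(ℂ); ℚ)` with a common index type `Fin N`, a smooth-projective witness `hX : IsSmoothProjective n A.X` and
degrees `j + i = 2n`, the socket operator `fourierSum hX b y i h : Hʲ(A(ℂ); ℚ) → Hⁱ(A(ℂ); ℚ)`,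
`z ↦ Σ_c tr(z ∪ m_i(b ∘ c)) • m_i(y ∘ c)`, is a linear bijection (b29's `bijective_of_eq_fourierSum` at the light
trace, which is injective on the top line). [cite: Kleiman1968AlgebraicCycles, Appendix 2A] -/
theorem fourierSum_bijective (hX : IsSmoothProjective n A.X) {N : ℕ}
    (b y : Module.Basis (Fin N) ℚ (bettiCohomology A.X 1)) (i : ℕ) {j : ℕ} (h : j + i = 2 * n) :
    Function.Bijective (fourierSum hX b y i h) :=
  bijective_of_eq_fourierSum A b y h
    (by rw [dim_unique hX (AbelianVariety.isSmoothProjective_holds (A := A))])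
    (BettiUniverse.tr hX (2 * n)) (tr_top_injective hX) (fourierSum hX b y i h)
    fun z ↦ by rw [fourierSum_apply]; rfl

/-- A linearly independent family in `H¹(A(ℂ); ℚ)` indexed like a basis of it is a basis (equal cardinality
`N = dim H¹(A(ℂ); ℚ)`). [folklore] -/
theorem exists_basis_coe_eq_of_linearIndependent {N : ℕ} (b : Module.Basis (Fin N) ℚ (bettiCohomology A.X 1))
    {y : Fin N → bettiCohomology A.X 1} (hy : LinearIndependent ℚ y) :
    ∃ y' : Module.Basis (Fin N) ℚ (bettiCohomology A.X 1), ⇑y' = y := by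
  haveI : FiniteDimensional ℚ (bettiCohomology A.X 1) :=
    BettiUniverse.finite (AbelianVariety.isSmoothProjective_holds (A := A)) 1
  have hcard : Fintype.card (Fin N) = Module.finrank ℚ (bettiCohomology A.X 1) :=
    (Module.finrank_eq_card_basis b).symm
  exact ⟨basisOfLinearIndependentOfCardEqFinrank' y hy hcard, coe_basisOfLinearIndependentOfCardEqFinrank' y hy hcard⟩

/-- **Row M22, clause (o), partner family merely independent**: for a basis `b` of `H¹(A(ℂ); ℚ)`, a linearly
independent family `y : Fin N → H¹(A(ℂ); ℚ)` (in K-a: the `θ`-polar family of `b`), `hX : IsSmoothProjective n A.X`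
and `j + i = 2n`, the socket operator `fourierSum hX b y i h` is bijective.
[cite: Kleiman1968AlgebraicCycles, Appendix 2A] -/
theorem fourierSum_bijective_of_linearIndependent (hX : IsSmoothProjective n A.X) {N : ℕ}
    (b : Module.Basis (Fin N) ℚ (bettiCohomology A.X 1)) {y : Fin N → bettiCohomology A.X 1}
    (hy : LinearIndependent ℚ y) (i : ℕ) {j : ℕ} (h : j + i = 2 * n) :
    Function.Bijective (fourierSum hX b y i h) := by
  obtain ⟨y', rfl⟩ := exists_basis_coe_eq_of_linearIndependent A b hy
  exact fourierSum_bijective A hX b y' i h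

/-- **Clause (o) in the shape of `Fact_algDuality`**: with `hX : IsSmoothProjective n A.X`, `2 ≤ n`, bases `b`, `y`
of `H¹(A(ℂ); ℚ)` and the degree identity `h : 2 * (n - 2) + 4 = 2 * n`, the operator
`fourierSum hX b y 4 h : H^{2(n-2)}(A(ℂ); ℚ) → H⁴(A(ℂ); ℚ)` is bijective (the instance K-a plugs into field (o)).
[cite: Kleiman1968AlgebraicCycles, Appendix 2A] -/
theorem fourierSum_bijective_four (hX : IsSmoothProjective n A.X) {N : ℕ}
    (b y : Module.Basis (Fin N) ℚ (bettiCohomology A.X 1)) (h : 2 * (n - 2) + 4 = 2 * n) :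
    Function.Bijective (fourierSum hX b y 4 h) :=
  fourierSum_bijective A hX b y 4 h

end Summit.HodgeConjecture.CorCM.Model

end
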